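import Summits.BirchSwinnertonDyer.BirchSwinnertonDyer.Theorems.ResidualThetaTransportAtTwoThetaLayerLambdaCongruenceAtTwoCuspSpanTriangleNRelation
import Summits.BirchSwinnertonDyer.BirchSwinnertonDyer.Theorems.ResidualThetaTransportAtTwoThetaLayerLambdaCongruenceAtTwoCuspSpanQuadratic
import HarnessLib

/-!
# Route `ResidualThetaTransportAtTwo`, cruxes Kan⁺ (stmt-BirchSwinnertonDyer-20688) / Kμ⁺ / 21437: the node `CuspSpanEvenAtTwo (p^a)`
# at EVERY ODD PRIME-POWER LEVEL — uniformly, without certificates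

Cell `bsd-wall`, width seat `bsd-wall-rtt-p3-w4` g2 (2026-08-28), lane «3-fold B₁-products at prime-power and composite level».
THEOREMS ONLY; `--supports stmt-BirchSwinnertonDyer-20688`; BSD is not proved by this. The three-fold product device is
`bsd-wall-rtt-p3-w2` g4's «q-adic triangles» (announced at prime level); the 4-invariance at prime powers is the lead's
`…CuspSpanFourInvariancePrimePow` (p634909); the level-`N` relation is `…CuspSpanTriangleNRelation`.

Let `p` be an odd prime, `a ≥ 1`, `χ : Γ₀(p^a) → 𝔽₂` additive, killing the elements of trace `0, ±1, ±2` and those with lower-right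
entry `±4^k` (`k ≥ 1`); `F(u) := χ(β)` for any `b = −1` element `β` with `d(β) ≡ u` (a unit mod `p^a`).
* §1 `chi_eq_of_b_neg_one_of_d_eq_four_pow_mul_primePow` — `F(4^K u) = F(u)` (iterate p634909).
* §2 `chi_add_chi_add_chi_eq_zero_primePow_of_ne_one` — `F(u) + F(v) + F(−uv) = 0` when `u ≢ 1 (mod p)` (the level-`N` relation
  gives `K` with `F(u) + F(v) + F(4^K/(uv)) = 0`; `F(4^K/(uv)) = F(1/(uv)) = F(−uv)` by §1 and the `S`-companion).
* §3 `chi_eq_of_b_neg_one_of_d_eq_neg_primePow` — EVENNESS `F(−u) = F(u)` (§2 with `v = 1` for `u ≢ 1`; else `−u ≢ 1`);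
  `chi_add_chi_add_chi_eq_zero_primePow` — `F(u) + F(v) + F(−uv) = 0` for ALL units (if `u ≡ v ≡ 1` use `−u, −v`).
* §4 `cuspSpanTrace_odd_primePow` — the trace form (G″)_{p^a}: `F` is multiplicative; `χ + F ∘ d̄` kills `B₁` and the small-trace
  elements (trace `±2`: `d = ±(1 + ε)`, `ε² = 0`, and `F(1 + ε) = F((1+ε)^{p^a}) = F(1) = 0`; trace `0, ±1`: the elliptic seed), so it
  vanishes by the (SUCC) descent `chi_eq_zero_of_forall_b1`; **`cuspSpanEvenAtTwo_odd_primePow : CuspSpanEvenAtTwo (p^a)`** for every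
  odd prime `p` and `a ≥ 1` — the node of 21437 / Kan⁺ / Kμ⁺ at all odd prime-power levels (27, 25, 49, 121, 125, 169, 243, 289, 343,
  361, …; the primes themselves are the announced deliverable of `rtt-p3-w2` g4 and are not separately restated here);
  `flatAtTwo_of_conductor_odd_primePow` — FLAT for every `W` good supersingular at `2` with `a₂ = 0` and odd prime-power conductor.

References: [Rademacher1929] §1; [Knapp1993] Prop. 11.1; [Pollack2003] Conj. 6.3, Prop. 6.18; [IrelandRosen1990] Ch. 4–5.
-/

set_option autoImplicit false
set_option linter.dupNamespace false

noncomputable section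

open scoped MatrixGroups

open CongruenceSubgroup WeierstrassCurve Literature.NumberTheory.EllipticCurves
  Literature.NumberTheory.EllipticCurves.ModularForms Literature.NumberTheory.EllipticCurves.Rank1Residual
  Literature.NumberTheory.IwasawaTheory Summit.BirchSwinnertonDyer.Rank1Residual.Supersingular

namespace Summit.BirchSwinnertonDyer.BirchSwinnertonDyer.Theorems.SignedMuAtTwo

section PrimePow

variable {p a : ℕ} [NeZero (p ^ a)] {χ : Gamma0 (p ^ a) → ZMod 2}

omit [NeZero (p ^ a)] in
/-- An odd prime power is odd. [folklore] -/
theorem TriangleN.odd_primePow (hp : p.Prime) (hp2 : p ≠ 2) : Odd (p ^ a) :=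
  ((hp.eq_two_or_odd').resolve_left hp2).pow

omit [NeZero (p ^ a)] in
/-- The residue of `d(β)` mod `p` from an identity mod `p^a`. [folklore] -/
theorem TriangleN.castHom_apply_one_one (ha : 1 ≤ a) (β : Gamma0 (p ^ a)) :
    ZMod.castHom (dvd_pow_self p (by omega) : p ∣ p ^ a) (ZMod p) ((((β : SL(2, ℤ)) 1 1 : ℤ) : ZMod (p ^ a))) =
      ((((β : SL(2, ℤ)) 1 1 : ℤ) : ZMod p)) :=
  map_intCast _ _

/-! ## §1. `F(4^K u) = F(u)` -/

/-- **`F(4^K u) = F(u)`** at an odd prime-power level (iterate the lead's 4-invariance p634909). [cite: Pollack2003, Conj. 6.3] -/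
theorem chi_eq_of_b_neg_one_of_d_eq_four_pow_mul_primePow (hp : p.Prime) (hp2 : p ≠ 2) (ha : 1 ≤ a)
    (hadd : ∀ γ δ : Gamma0 (p ^ a), χ (γ * δ) = χ γ + χ δ)
    (hsmall : ∀ γ : Gamma0 (p ^ a), ((γ : SL(2, ℤ)) 0 0 + (γ : SL(2, ℤ)) 1 1).natAbs ≤ 2 → χ γ = 0)
    (hkill : ∀ γ : Gamma0 (p ^ a), (∃ k : ℕ, 1 ≤ k ∧ ((γ : SL(2, ℤ)) 1 1).natAbs = 4 ^ k) → χ γ = 0)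
    (K : ℕ) {β β' : Gamma0 (p ^ a)} (hb : (β : SL(2, ℤ)) 0 1 = -1) (hb' : (β' : SL(2, ℤ)) 0 1 = -1)
    (h : ((((β : SL(2, ℤ)) 1 1 : ℤ) : ZMod (p ^ a))) = 4 ^ K * ((((β' : SL(2, ℤ)) 1 1 : ℤ) : ZMod (p ^ a)))) :
    χ β = χ β' := by
  induction K generalizing β with
  | zero => exact chi_eq_of_apply_zero_one_eq_neg_one hadd hsmall hb hb' (by rw [h, pow_zero, one_mul])
  | succ K ih =>
    have h4 : IsUnit ((4 : ZMod (p ^ a))) := by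
      have := (ZMod.coe_int_isUnit_iff_isCoprime 4 (p ^ a)).mpr
        (by exact_mod_cast (TriangleN.isCoprime_four_of_odd (TriangleN.odd_primePow hp hp2)).symm)
      exact_mod_cast this
    have hw : IsUnit ((4 : ZMod (p ^ a)) ^ K * ((((β' : SL(2, ℤ)) 1 1 : ℤ) : ZMod (p ^ a)))) :=
      (h4.pow K).mul (isUnit_gamma0_apply_one_one β')
    obtain ⟨β'', hb'', hd''⟩ := exists_b_neg_one_of_isUnit hw
    have e1 : χ β = χ β'' :=
      chi_eq_of_b_neg_one_of_d_eq_four_mul_primePow hp hp2 ha hadd hsmall hkill hb hb''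
        (by rw [h, hd'', pow_succ]; ring)
    rw [e1]
    exact ih hb'' hd''

/-! ## §2. The product rule off the class `u ≡ 1 (mod p)` -/

/-- **`F(u) + F(v) + F(−uv) = 0` when `u ≢ 1 (mod p)`.** [cite: Pollack2003, Conj. 6.3] -/
theorem chi_add_chi_add_chi_eq_zero_primePow_of_ne_one (hp : p.Prime) (hp2 : p ≠ 2) (ha : 1 ≤ a)
    (hadd : ∀ γ δ : Gamma0 (p ^ a), χ (γ * δ) = χ γ + χ δ)
    (hsmall : ∀ γ : Gamma0 (p ^ a), ((γ : SL(2, ℤ)) 0 0 + (γ : SL(2, ℤ)) 1 1).natAbs ≤ 2 → χ γ = 0)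
    (hkill : ∀ γ : Gamma0 (p ^ a), (∃ k : ℕ, 1 ≤ k ∧ ((γ : SL(2, ℤ)) 1 1).natAbs = 4 ^ k) → χ γ = 0)
    {β₁ β₂ β₃ : Gamma0 (p ^ a)} (hb1 : (β₁ : SL(2, ℤ)) 0 1 = -1) (hb2 : (β₂ : SL(2, ℤ)) 0 1 = -1)
    (hb3 : (β₃ : SL(2, ℤ)) 0 1 = -1) (hu1 : ((((β₁ : SL(2, ℤ)) 1 1 : ℤ) : ZMod p)) ≠ 1)
    (h3 : ((((β₃ : SL(2, ℤ)) 1 1 : ℤ) : ZMod (p ^ a))) =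
      -(((((β₁ : SL(2, ℤ)) 1 1 : ℤ) : ZMod (p ^ a))) * ((((β₂ : SL(2, ℤ)) 1 1 : ℤ) : ZMod (p ^ a))))) :
    χ β₁ + χ β₂ + χ β₃ = 0 := by
  have hu1' : ∀ ℓ : ℕ, ℓ.Prime → ℓ ∣ p ^ a → ((((β₁ : SL(2, ℤ)) 1 1 : ℤ) : ZMod ℓ)) ≠ 1 := by
    intro ℓ hℓ hℓd
    have : ℓ = p := (Nat.prime_dvd_prime_iff_eq hℓ hp).mp (hℓ.dvd_of_dvd_pow hℓd)
    subst this
    exact hu1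
  obtain ⟨K, -, hrel⟩ := TriangleN.chi_add_chi_add_chi_eq_zero_levelN (TriangleN.odd_primePow hp hp2) hadd hsmall hkill
    hb1 hb2 hu1'
  set u : ZMod (p ^ a) := ((((β₁ : SL(2, ℤ)) 1 1 : ℤ) : ZMod (p ^ a))) with hu_def
  set v : ZMod (p ^ a) := ((((β₂ : SL(2, ℤ)) 1 1 : ℤ) : ZMod (p ^ a))) with hv_def
  have huv : IsUnit (u * v) := (isUnit_gamma0_apply_one_one β₁).mul (isUnit_gamma0_apply_one_one β₂)
  have h4 : IsUnit ((4 : ZMod (p ^ a))) := by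
    have := (ZMod.coe_int_isUnit_iff_isCoprime 4 (p ^ a)).mpr
      (by exact_mod_cast (TriangleN.isCoprime_four_of_odd (TriangleN.odd_primePow hp hp2)).symm)
    exact_mod_cast this
  -- `β₃'` with `d ≡ 4^K (uv)⁻¹`, `β₃''` with `d ≡ (uv)⁻¹`
  have hinvu : IsUnit ((huv.unit⁻¹ : (ZMod (p ^ a))ˣ) : ZMod (p ^ a)) := Units.isUnit _
  obtain ⟨β₃', hb3', hd3'⟩ := exists_b_neg_one_of_isUnit ((h4.pow K).mul hinvu)
  obtain ⟨β₃'', hb3'', hd3''⟩ := exists_b_neg_one_of_isUnit hinvu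
  have hrel' := hrel β₃' hb3' (by
    rw [hd3', mul_comm ((4 : ZMod (p ^ a)) ^ K), ← mul_assoc, IsUnit.mul_val_inv, one_mul])
  have e1 : χ β₃' = χ β₃'' :=
    chi_eq_of_b_neg_one_of_d_eq_four_pow_mul_primePow hp hp2 ha hadd hsmall hkill K hb3' hb3'' (by rw [hd3', hd3''])
  have e2 : χ β₃'' = χ β₃ :=
    chi_eq_of_b_neg_one_of_mul_d_eq_neg_one hadd hsmall hb3'' hb3 (by rw [hd3'', h3, mul_neg, IsUnit.val_inv_mul])
  rw [← e2, ← e1]; exact hrel'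

/-! ## §3. Evenness and the product rule for all units -/

omit [NeZero (p ^ a)] in
/-- A `b = −1` element with `d ≡ 1` has `χ = 0` (it is `χ`-equivalent to `T⁻¹`). [folklore] -/
theorem chi_eq_zero_of_b_neg_one_of_d_eq_one
    (hadd : ∀ γ δ : Gamma0 (p ^ a), χ (γ * δ) = χ γ + χ δ)
    (hsmall : ∀ γ : Gamma0 (p ^ a), ((γ : SL(2, ℤ)) 0 0 + (γ : SL(2, ℤ)) 1 1).natAbs ≤ 2 → χ γ = 0)
    {β : Gamma0 (p ^ a)} (hb : (β : SL(2, ℤ)) 0 1 = -1) (hd : ((((β : SL(2, ℤ)) 1 1 : ℤ) : ZMod (p ^ a))) = 1) :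
    χ β = 0 := by
  obtain ⟨e, he00, he01, -, he11⟩ :=
    ThetaLayerLambdaCongruenceAtTwo.exists_gamma0_entries (N := p ^ a) 1 (-1) 0 1 (by ring) (dvd_zero _)
  rw [chi_eq_of_apply_zero_one_eq_neg_one hadd hsmall hb he01 (by rw [hd, he11]; push_cast; rfl)]
  exact hsmall e (by rw [he00, he11]; decide)

/-- **Evenness `F(−u) = F(u)`** at an odd prime-power level. [cite: Pollack2003, Conj. 6.3] -/
theorem chi_eq_of_b_neg_one_of_d_eq_neg_primePow (hp : p.Prime) (hp2 : p ≠ 2) (ha : 1 ≤ a)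
    (hadd : ∀ γ δ : Gamma0 (p ^ a), χ (γ * δ) = χ γ + χ δ)
    (hsmall : ∀ γ : Gamma0 (p ^ a), ((γ : SL(2, ℤ)) 0 0 + (γ : SL(2, ℤ)) 1 1).natAbs ≤ 2 → χ γ = 0)
    (hkill : ∀ γ : Gamma0 (p ^ a), (∃ k : ℕ, 1 ≤ k ∧ ((γ : SL(2, ℤ)) 1 1).natAbs = 4 ^ k) → χ γ = 0)
    {β β' : Gamma0 (p ^ a)} (hb : (β : SL(2, ℤ)) 0 1 = -1) (hb' : (β' : SL(2, ℤ)) 0 1 = -1)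
    (h : ((((β' : SL(2, ℤ)) 1 1 : ℤ) : ZMod (p ^ a))) = -((((β : SL(2, ℤ)) 1 1 : ℤ) : ZMod (p ^ a)))) :
    χ β = χ β' := by
  haveI := Fact.mk hp
  -- the `d ≡ 1` element
  obtain ⟨β₀, hb0, hd0⟩ := exists_b_neg_one_of_isUnit (N := p ^ a) (isUnit_one)
  have hχ0 : χ β₀ = 0 := chi_eq_zero_of_b_neg_one_of_d_eq_one hadd hsmall hb0 hd0
  -- the case `d(β) ≢ 1 (mod p)`, for any pair
  have key : ∀ {γ γ' : Gamma0 (p ^ a)}, (γ : SL(2, ℤ)) 0 1 = -1 → (γ' : SL(2, ℤ)) 0 1 = -1 →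
      ((((γ' : SL(2, ℤ)) 1 1 : ℤ) : ZMod (p ^ a))) = -((((γ : SL(2, ℤ)) 1 1 : ℤ) : ZMod (p ^ a))) →
      ((((γ : SL(2, ℤ)) 1 1 : ℤ) : ZMod p)) ≠ 1 → χ γ = χ γ' := by
    intro γ γ' hg hg' hneg hne
    have hsum := chi_add_chi_add_chi_eq_zero_primePow_of_ne_one hp hp2 ha hadd hsmall hkill hg hb0 hg' hne
      (by rw [hneg, hd0, mul_one])
    rw [hχ0, add_zero, add_eq_zero_iff_eq_neg, ZMod.neg_eq_self_mod_two] at hsum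
    exact hsum
  by_cases hne : ((((β : SL(2, ℤ)) 1 1 : ℤ) : ZMod p)) = 1
  · -- then `d(β') ≡ −1 ≢ 1 (mod p)`
    have hne' : ((((β' : SL(2, ℤ)) 1 1 : ℤ) : ZMod p)) ≠ 1 := by
      have e := congrArg (ZMod.castHom (dvd_pow_self p (by omega) : p ∣ p ^ a) (ZMod p)) h
      rw [map_neg, TriangleN.castHom_apply_one_one ha, TriangleN.castHom_apply_one_one ha, hne] at e
      rw [e]
      exact Ring.neg_one_ne_one_of_char_ne_two (by rw [ZMod.ringChar_zmod_n]; exact hp2)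
    exact (key hb' hb (by rw [h, neg_neg]) hne').symm
  · exact key hb hb' h hne

/-- **`F(u) + F(v) + F(−uv) = 0` for ALL units** at an odd prime-power level. [cite: Pollack2003, Conj. 6.3] -/
theorem chi_add_chi_add_chi_eq_zero_primePow (hp : p.Prime) (hp2 : p ≠ 2) (ha : 1 ≤ a)
    (hadd : ∀ γ δ : Gamma0 (p ^ a), χ (γ * δ) = χ γ + χ δ)
    (hsmall : ∀ γ : Gamma0 (p ^ a), ((γ : SL(2, ℤ)) 0 0 + (γ : SL(2, ℤ)) 1 1).natAbs ≤ 2 → χ γ = 0)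
    (hkill : ∀ γ : Gamma0 (p ^ a), (∃ k : ℕ, 1 ≤ k ∧ ((γ : SL(2, ℤ)) 1 1).natAbs = 4 ^ k) → χ γ = 0)
    {β₁ β₂ β₃ : Gamma0 (p ^ a)} (hb1 : (β₁ : SL(2, ℤ)) 0 1 = -1) (hb2 : (β₂ : SL(2, ℤ)) 0 1 = -1)
    (hb3 : (β₃ : SL(2, ℤ)) 0 1 = -1)
    (h3 : ((((β₃ : SL(2, ℤ)) 1 1 : ℤ) : ZMod (p ^ a))) =
      -(((((β₁ : SL(2, ℤ)) 1 1 : ℤ) : ZMod (p ^ a))) * ((((β₂ : SL(2, ℤ)) 1 1 : ℤ) : ZMod (p ^ a))))) :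
    χ β₁ + χ β₂ + χ β₃ = 0 := by
  haveI := Fact.mk hp
  by_cases h1 : ((((β₁ : SL(2, ℤ)) 1 1 : ℤ) : ZMod p)) = 1
  · by_cases h2 : ((((β₂ : SL(2, ℤ)) 1 1 : ℤ) : ZMod p)) = 1
    · -- both `≡ 1 (mod p)`: replace by `−u, −v`
      obtain ⟨γ₁, hg1, hd1⟩ := exists_b_neg_one_of_isUnit (isUnit_gamma0_apply_one_one β₁).neg
      obtain ⟨γ₂, hg2, hd2⟩ := exists_b_neg_one_of_isUnit (isUnit_gamma0_apply_one_one β₂).neg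
      have hne : ((((γ₁ : SL(2, ℤ)) 1 1 : ℤ) : ZMod p)) ≠ 1 := by
        have e := congrArg (ZMod.castHom (dvd_pow_self p (by omega) : p ∣ p ^ a) (ZMod p)) hd1
        rw [map_neg, TriangleN.castHom_apply_one_one ha, TriangleN.castHom_apply_one_one ha, h1] at e
        rw [e]
        exact Ring.neg_one_ne_one_of_char_ne_two (by rw [ZMod.ringChar_zmod_n]; exact hp2)
      have e1 : χ β₁ = χ γ₁ := chi_eq_of_b_neg_one_of_d_eq_neg_primePow hp hp2 ha hadd hsmall hkill hb1 hg1 hd1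
      have e2 : χ β₂ = χ γ₂ := chi_eq_of_b_neg_one_of_d_eq_neg_primePow hp hp2 ha hadd hsmall hkill hb2 hg2 hd2
      rw [e1, e2]
      exact chi_add_chi_add_chi_eq_zero_primePow_of_ne_one hp hp2 ha hadd hsmall hkill hg1 hg2 hb3 hne
        (by rw [h3, hd1, hd2]; ring)
    · have := chi_add_chi_add_chi_eq_zero_primePow_of_ne_one hp hp2 ha hadd hsmall hkill hb2 hb1 hb3 h2
        (by rw [h3, mul_comm])
      rw [← this]; ring
  · exact chi_add_chi_add_chi_eq_zero_primePow_of_ne_one hp hp2 ha hadd hsmall hkill hb1 hb2 hb3 h1 h3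

/-! ## §4. The trace form and the node at every odd prime power -/

/-- `(1 + ε)^n = 1 + n ε` when `ε² = 0`. [folklore] -/
theorem TriangleN.one_add_pow_of_sq_zero {R : Type*} [CommRing R] (ε : R) (hε : ε * ε = 0) (n : ℕ) :
    (1 + ε) ^ n = 1 + n * ε := by
  induction n with
  | zero => simp
  | succ n ih => rw [pow_succ, ih]; push_cast; linear_combination (n : R) * hε

/-- **The trace form (G″) at every odd prime-power level.** [cite: Pollack2003, Conj. 6.3] [cite: Rademacher1929, §1] -/
theorem cuspSpanTrace_odd_primePow (hp : p.Prime) (hp2 : p ≠ 2) (ha : 1 ≤ a) :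
    ∀ χ : Gamma0 (p ^ a) → ZMod 2,
      (∀ γ δ : Gamma0 (p ^ a), χ (γ * δ) = χ γ + χ δ) →
      (∀ γ : Gamma0 (p ^ a), ((γ : SL(2, ℤ)) 0 0 + (γ : SL(2, ℤ)) 1 1).natAbs ≤ 2 → χ γ = 0) →
      (∀ γ : Gamma0 (p ^ a), (∃ k : ℕ, 1 ≤ k ∧ ((γ : SL(2, ℤ)) 1 1).natAbs = 4 ^ k) → χ γ = 0) →
      ∃ ψ : ZMod (p ^ a) → ZMod 2, (∀ x y : ZMod (p ^ a), IsUnit x → IsUnit y → ψ (x * y) = ψ x + ψ y) ∧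
        ∀ γ : Gamma0 (p ^ a), χ γ = ψ ((((γ : SL(2, ℤ)) 1 1 : ℤ) : ZMod (p ^ a))) := by
  classical
  intro χ hadd hsmall hkill
  haveI := Fact.mk hp
  -- the `B₁`-character
  have hex : ∀ r : ZMod (p ^ a), IsUnit r → ∃ β : Gamma0 (p ^ a), (β : SL(2, ℤ)) 0 1 = -1 ∧ ((((β : SL(2, ℤ)) 1 1 : ℤ) : ZMod (p ^ a))) = r :=
    fun r hr ↦ exists_b_neg_one_of_isUnit hr
  let F : ZMod (p ^ a) → ZMod 2 := fun r ↦ if h : IsUnit r then χ (Classical.choose (hex r h)) else 0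
  have hF : ∀ β : Gamma0 (p ^ a), (β : SL(2, ℤ)) 0 1 = -1 → F ((((β : SL(2, ℤ)) 1 1 : ℤ) : ZMod (p ^ a))) = χ β := by
    intro β hb
    have hr : IsUnit ((((β : SL(2, ℤ)) 1 1 : ℤ) : ZMod (p ^ a))) := isUnit_gamma0_apply_one_one β
    have hs := Classical.choose_spec (hex _ hr)
    simp only [F, dif_pos hr]
    exact chi_eq_of_apply_zero_one_eq_neg_one hadd hsmall hs.1 hb hs.2
  have h1 : F 1 = 0 := by
    obtain ⟨β₀, hb0, hd0⟩ := hex 1 isUnit_one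
    rw [← hd0, hF β₀ hb0]
    exact chi_eq_zero_of_b_neg_one_of_d_eq_one hadd hsmall hb0 hd0
  -- multiplicativity on units
  have hmult : ∀ x y : ZMod (p ^ a), IsUnit x → IsUnit y → F (x * y) = F x + F y := by
    intro x y hx hy
    obtain ⟨βx, hbx, hdx⟩ := hex x hx
    obtain ⟨βy, hby, hdy⟩ := hex y hy
    obtain ⟨βxy, hbxy, hdxy⟩ := hex (x * y) (hx.mul hy)
    obtain ⟨βm, hbm, hdm⟩ := hex (-(x * y)) (hx.mul hy).neg
    have hsum := chi_add_chi_add_chi_eq_zero_primePow hp hp2 ha hadd hsmall hkill hbx hby hbm (by rw [hdm, hdx, hdy])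
    have hev : χ βxy = χ βm := chi_eq_of_b_neg_one_of_d_eq_neg_primePow hp hp2 ha hadd hsmall hkill hbxy hbm
      (by rw [hdm, hdxy])
    rw [← hdxy, ← hdx, ← hdy, hF βx hbx, hF βy hby, hF βxy hbxy, hev]
    rw [add_eq_zero_iff_eq_neg, ZMod.neg_eq_self_mod_two] at hsum
    exact hsum.symm
  -- powers: `F(x^n) = n F(x)`
  have hpow : ∀ (x : ZMod (p ^ a)), IsUnit x → ∀ n : ℕ, F (x ^ n) = n * F x := by
    intro x hx n
    induction n with
    | zero => rw [pow_zero, h1]; simp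
    | succ n ih => rw [pow_succ, hmult _ _ (hx.pow n) hx, ih]; push_cast; ring
  refine ⟨F, hmult, ?_⟩
  -- `χ' = χ + F ∘ d̄` vanishes
  let χ' : Gamma0 (p ^ a) → ZMod 2 := fun γ ↦ χ γ + F ((((γ : SL(2, ℤ)) 1 1 : ℤ) : ZMod (p ^ a)))
  have hadd' : ∀ γ δ : Gamma0 (p ^ a), χ' (γ * δ) = χ' γ + χ' δ := by
    intro γ δ
    simp only [χ']
    rw [cast_mul_apply_one_one, hmult _ _ (isUnit_gamma0_apply_one_one γ) (isUnit_gamma0_apply_one_one δ), hadd]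
    ring
  have hS : F (-1) = 0 := by
    obtain ⟨β₀, hb0, hd0⟩ := hex 1 isUnit_one
    obtain ⟨βm, hbm, hdm⟩ := hex (-1) isUnit_one.neg
    rw [← hdm, hF βm hbm, ← chi_eq_of_b_neg_one_of_mul_d_eq_neg_one hadd hsmall hb0 hbm (by rw [hd0, hdm]; ring),
      ← hF β₀ hb0, hd0, h1]
  have hnil : ∀ ε : ZMod (p ^ a), ε * ε = 0 → F (1 + ε) = 0 := by
    intro ε hε
    have hu : IsUnit (1 + ε) := by
      exact IsUnit.of_mul_eq_one (1 - ε) (by linear_combination -hε)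
    have e1 : F ((1 + ε) ^ (p ^ a)) = ((p ^ a : ℕ) : ZMod 2) * F (1 + ε) := hpow _ hu (p ^ a)
    rw [TriangleN.one_add_pow_of_sq_zero ε hε] at e1
    have hNz : ((p ^ a : ℕ) : ZMod (p ^ a)) = 0 := ZMod.natCast_self _
    rw [hNz, zero_mul, add_zero, h1] at e1
    have hodd : ((p ^ a : ℕ) : ZMod 2) = 1 := by
      rw [ZMod.natCast_eq_one_iff_odd]; exact TriangleN.odd_primePow hp hp2
    rw [hodd, one_mul] at e1
    exact e1.symm
  have hsmall' : ∀ γ : Gamma0 (p ^ a), ((γ : SL(2, ℤ)) 0 0 + (γ : SL(2, ℤ)) 1 1).natAbs ≤ 2 → χ' γ = 0 := by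
    intro γ ht
    simp only [χ']
    rw [hsmall γ ht, zero_add]
    set d : ZMod (p ^ a) := ((((γ : SL(2, ℤ)) 1 1 : ℤ) : ZMod (p ^ a))) with hd
    set t : ℤ := (γ : SL(2, ℤ)) 0 0 + (γ : SL(2, ℤ)) 1 1 with htdef
    have hsq : d * d = (t : ZMod (p ^ a)) * d - 1 := cast_apply_one_one_sq γ
    have hcases : t = -2 ∨ t = -1 ∨ t = 0 ∨ t = 1 ∨ t = 2 := by omega
    have hell : ∀ t' : ℤ, t'.natAbs ≤ 1 → d * d + t' * d + 1 = 0 → F d = 0 := by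
      intro t' ht' h
      obtain ⟨β, hb, hdb⟩ := hex d (isUnit_gamma0_apply_one_one γ)
      rw [← hdb, hF β hb]
      refine chi_eq_zero_of_b_neg_one_of_elliptic hadd hsmall β hb ((γ : SL(2, ℤ)) 1 1) t' ht' ?_ (by rw [hdb])
      rw [← ZMod.intCast_zmod_eq_zero_iff_dvd]
      push_cast
      rw [← hd]; exact h
    rcases hcases with h | h | h | h | h <;> rw [h] at hsq <;> push_cast at hsq
    · -- `t = −2`: `d = −(1 + ε)`, `ε = −d − 1`, `ε² = 0`
      have hε : (-d - 1) * (-d - 1) = 0 := by linear_combination hsq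
      have e : d = (-1) * (1 + (-d - 1)) := by ring
      rw [e, hmult _ _ isUnit_one.neg (IsUnit.of_mul_eq_one (1 - (-d - 1)) (by linear_combination -hε)), hS,
        hnil _ hε, add_zero]
    · exact hell 1 (by decide) (by push_cast; linear_combination hsq)
    · exact hell 0 (by decide) (by push_cast; linear_combination hsq)
    · exact hell (-1) (by decide) (by push_cast; linear_combination hsq)
    · -- `t = 2`: `d = 1 + ε`
      have hε : (d - 1) * (d - 1) = 0 := by linear_combination hsq
      have e : d = 1 + (d - 1) := by ring
      rw [e]; exact hnil _ hε
  have hB' : ∀ β : Gamma0 (p ^ a), (β : SL(2, ℤ)) 0 1 = -1 → χ' β = 0 := by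
    intro β hb
    simp only [χ']
    rw [hF β hb]
    exact CharTwo.add_self_eq_zero _
  have hzero := chi_eq_zero_of_forall_b1 (isUnit_or_isUnit_succ_of_primePow hp) hadd' hsmall'
    (forall_b1_of_forall_b_neg_one hadd' hB')
  intro γ
  have h := hzero γ
  simp only [χ'] at h
  have e : χ γ = -F ((((γ : SL(2, ℤ)) 1 1 : ℤ) : ZMod (p ^ a))) := by linear_combination h
  rw [e, ZMod.neg_eq_self_mod_two]

/-- **`CuspSpanEvenAtTwo (p^a)` for every odd prime `p` and every `a ≥ 1`** — the node (G′)_N of 21437 / Kan⁺ / Kμ⁺ at all odd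
prime-power levels, uniformly, with no certificate and no conjecture-grade input. BSD is not proved by this.
[cite: Pollack2003, Conj. 6.3] [cite: Rademacher1929, §1] -/
theorem cuspSpanEvenAtTwo_odd_primePow (hp : p.Prime) (hp2 : p ≠ 2) (ha : 1 ≤ a) : CuspSpanEvenAtTwo (p ^ a) :=
  cuspSpanEvenAtTwo_of_cuspSpanTrace (cuspSpanTrace_odd_primePow hp hp2 ha)

end PrimePow

/-! ## FLAT for habitat⁺ curves of odd prime-power conductor -/

section Flat

variable {W : WeierstrassCurve ℚ} [W.IsElliptic] [W.IsGloballyMinimal]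

/-- **FLAT at every odd prime-power conductor.** For `W/ℚ` good supersingular at `2` with `a₂(W) = 0`, newform `f`, and conductor
`N_W = p^a` (`p` an odd prime, `a ≥ 1`): `2 ∤ L⁻` for every Pollack pair `(L⁺, L⁻)` of `f` at `2` — crux Kμ⁺'s FLAT statement
is a THEOREM on this class. BSD is not proved by this. [cite: Pollack2003, Conj. 6.3 and Prop. 6.18] -/
theorem flatAtTwo_of_conductor_odd_primePow [NeZero (W.conductorNorm ℤ)] {f : CuspForm (Gamma0 (W.conductorNorm ℤ)) 2}
    (hf : IsNewformOf W f) (hss : GoodSS W 2) (ha2 : W.frobeniusTrace 2 = 0)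
    {p a : ℕ} (hp : p.Prime) (hp2 : p ≠ 2) (ha : 1 ≤ a) (hN : W.conductorNorm ℤ = p ^ a) :
    ∀ Lplus Lminus : IwasawaAlgebra 2, IsPollackPair f 2 Lplus Lminus → ¬ PowerSeries.C (2 : ℤ_[2]) ∣ Lminus := by
  refine flatAtTwo_of_cuspSpanEvenAtTwo hf hss ha2 ?_
  haveI : NeZero (p ^ a) := ⟨pow_ne_zero _ hp.ne_zero⟩
  have h := cuspSpanEvenAtTwo_odd_primePow (p := p) (a := a) hp hp2 ha
  revert h
  generalize hM : W.conductorNorm ℤ = M at *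
  subst hN
  intro h
  convert h

end Flat

end Summit.BirchSwinnertonDyer.BirchSwinnertonDyer.Theorems.SignedMuAtTwo

end
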